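import Literature.Computability.AlgebraicComplexity.TokenCircuits
import Literature.Computability.AlgebraicComplexity.ConstantFreeValiant
import Literature.Computability.AlgebraicComplexity.DepthReductionProofs
import Literature.Computability.AlgebraicComplexity.ConstantFreeCircuits
import HarnessLib

/-!
# From constant-free circuits to normalized circuits

Step A-III of the constant-free completeness proof for the permanent behind Bürgisser 2009,
Thm. 2.10 (`ConstantFreeCompleteness.Burgisser2009_perProjection`): a fan-in-two circuit `P`
over `ℤ` with sign constants in the variables `S ⊕ Fin u` (the `Fin u` ones being the Boolean
variables of a Boolean sum) is turned into a normalized circuit `P.toNCirc : NCirc (MvPolynomial S ℤ)`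
(`TokenCircuits.lean`) with the `u` Boolean leaves first and five nodes per gate
(operand `0`, operand `1`, `coef₀ · op₀`, `coef₁ · op₁`, and the `add`/`mul` node), then the
output operand's node and the root `pass 1`.  The one subtlety is Bürgisser's formal degree:
gates of formal degree `0` (empty gates and what is built from them) compute integer constants,
possibly huge (`2^{2^s}`), and are COLLAPSED to leaves labelled by their value `C c`, a constant
of `τ`-complexity `≤ |P|` (`constantFreeComplexity_cval_le`: the prefix circuit computes it);
references to them would otherwise break the degree budget of the token expansion.

* `NCirc.ofKind` — a normalized circuit from a kind function (formal degrees and values by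
  well-founded recursion, `fdOf_eq`, `valOf_eq`);
* `ArithCircuit.kindC`, `ArithCircuit.toNCirc`;
* `ArithCircuit.val_root` — **values**: `val_e (root) = P.eval (X, e)` (`φ e = aeval (X, e)`) for
  every Boolean point `e` of the Boolean variables;
* `ArithCircuit.fd_root` — **formal degree**: `fd (root) ≤ (|P| + 1) · formalDegree P + 1`
  (`fd (main g) ≤ (g + 2) d_g` for the gates of formal degree `d_g ≥ 1`, `fd_main`);
* `ArithCircuit.GoodParam`, `ArithCircuit.paramIn_kindC` — **parameters**: every leaf label and
  coefficient is `0`, `1`, `-1`, a variable `X v`, or `C c` with `τ(C c) ≤ |P|`.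

## References

* P. Bürgisser, *On defining integers and proving arithmetic circuit lower bounds*,
  Comput. Complexity 18 (2009) 81–103, §2.2 (formal degree) and Thm. 2.10 (ECCC TR06-113, p. 8).
* G. Malod, N. Portier, *Characterizing Valiant's algebraic complexity classes*, J. Complexity
  24 (2008) 16–38, Lemma 2 (reduced circuits / homogeneous components by formal degree).
-/

namespace Literature.Computability.AlgebraicComplexity

open MvPolynomial

universe u

/-! ### Normalized circuits from a kind function -/

namespace NK

variable {R : Type u}

/-- `fdeg` only reads the children. [folklore] -/
theorem fdeg_congr (k : NK R) {d d' : ℕ → ℕ} (h : ∀ a ∈ k.children, d a = d' a) : k.fdeg d = k.fdeg d' := by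
  cases k <;> simp_all [fdeg, children]

/-- `eval` only reads the children. [folklore] -/
theorem eval_congr [CommRing R] (k : NK R) (e : ℕ → Bool) (i : ℕ) {v v' : ℕ → R} (h : ∀ a ∈ k.children, v a = v' a) :
    k.eval e i v = k.eval e i v' := by
  cases k <;> simp_all [eval, children]

end NK

namespace NCirc

variable {R : Type u}

/-- Formal degrees from a kind function, by well-founded recursion. [folklore] -/
noncomputable def fdOf (kind : ℕ → NK R) : ℕ → ℕ :=
  WellFounded.fix Nat.lt_wfRel.wf fun i rec => (kind i).fdeg fun j => if h : j < i then rec j h else 0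

/-- Values from a kind function, by well-founded recursion. [folklore] -/
noncomputable def valOf [CommRing R] (kind : ℕ → NK R) (e : ℕ → Bool) : ℕ → R :=
  WellFounded.fix Nat.lt_wfRel.wf fun i rec => (kind i).eval e i fun j => if h : j < i then rec j h else 0

/-- The recursion equation of `fdOf`. [folklore] -/
theorem fdOf_eq (kind : ℕ → NK R) (i : ℕ) (hwf : ∀ a ∈ (kind i).children, a < i) :
    fdOf kind i = (kind i).fdeg (fdOf kind) := by
  unfold fdOf
  rw [WellFounded.fix_eq]
  exact (kind i).fdeg_congr fun a ha => by rw [dif_pos (hwf a ha)]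

/-- The recursion equation of `valOf`. [folklore] -/
theorem valOf_eq [CommRing R] (kind : ℕ → NK R) (e : ℕ → Bool) (i : ℕ) (hwf : ∀ a ∈ (kind i).children, a < i) :
    valOf kind e i = (kind i).eval e i (valOf kind e) := by
  unfold valOf
  rw [WellFounded.fix_eq]
  exact (kind i).eval_congr e i fun a ha => by rw [dif_pos (hwf a ha)]

/-- **A normalized circuit from a kind function** with children below and the Boolean leaves
first. [folklore] -/
noncomputable def ofKind [CommRing R] (u m : ℕ) (hum : u ≤ m) (kind : ℕ → NK R)
    (hwf : ∀ i, ∀ a ∈ (kind i).children, a < i) (hevar : ∀ i < m, kind i = NK.evar ↔ i < u) : NCirc R where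
  u := u
  m := m
  u_le := hum
  kind := kind
  kind_evar := hevar
  wf i _ := hwf i
  fd := fdOf kind
  fd_eq i _ := fdOf_eq kind i (hwf i)
  val := valOf kind
  val_eq e i _ := valOf_eq kind e i (hwf i)

end NCirc

/-! ### The kind function of a constant-free circuit -/

noncomputable section

namespace ArithCircuit

variable {S : Type} {u : ℕ}

section Kind

variable (gs : List (Gate ℤ (S ⊕ Fin u)))

/-- The constant value of a gate (meaningful for gates of formal degree `0`). [folklore] -/
def cval (j : ℕ) : ℤ := coeff 0 ((gateValues gs).getD j 0)

/-- The node of an operand of gate number `g` (or of the output, `g = |gs|`): ring variables and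
constants are leaves, a Boolean variable `e_j` is read through `pass 1 j`, a reference to an
earlier gate of formal degree `≥ 1` through `pass 1 (its main node)`, a reference to an earlier
gate of formal degree `0` is the leaf labelled by its (constant) value, a junk reference is the
leaf `0`, a missing operand the leaf `dflt`. [folklore] -/
def opKind (g : ℕ) (dflt : MvPolynomial S ℤ) :
    Option (Operand ℤ (S ⊕ Fin u)) → NK (MvPolynomial S ℤ)
  | none => NK.leaf dflt
  | some (.var (Sum.inl x)) => NK.leaf (X x)
  | some (.var (Sum.inr j)) => NK.pass 1 j.val
  | some (.const c) => NK.leaf (C c)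
  | some (.gate j) =>
      if j < g then
        (if (gateFormalDegrees gs).getD j 1 = 0 then NK.leaf (C (cval gs j)) else NK.pass 1 (u + 5 * j + 4))
      else NK.leaf 0

/-- The coefficient of the `r`-th operand (`1` for product gates, `0` for a missing operand). [folklore] -/
def coefOf : Gate ℤ (S ⊕ Fin u) → ℕ → MvPolynomial S ℤ
  | .sum args, r => (args[r]?.map fun a => C a.1).getD 0
  | .prod _, _ => 1

/-- The neutral element of the gate. [folklore] -/
def dfltOf : Gate ℤ (S ⊕ Fin u) → MvPolynomial S ℤ
  | .sum _ => 0
  | .prod _ => 1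

/-- The main node of a gate. [folklore] -/
def mainKind : Gate ℤ (S ⊕ Fin u) → ℕ → ℕ → NK (MvPolynomial S ℤ)
  | .sum _, a, b => NK.add a b
  | .prod _, a, b => NK.mul a b

/-- The five nodes of gate `g`: operand `0`, operand `1`, `coef₀ ·`, `coef₁ ·`, main. [folklore] -/
def gateKind (g : ℕ) (gt : Gate ℤ (S ⊕ Fin u)) (r : ℕ) : NK (MvPolynomial S ℤ) :=
  if r = 0 then opKind gs g (dfltOf gt) gt.args[0]?
  else if r = 1 then opKind gs g (dfltOf gt) gt.args[1]?
  else if r = 2 then NK.pass (coefOf gt 0) (u + 5 * g)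
  else if r = 3 then NK.pass (coefOf gt 1) (u + 5 * g + 1)
  else mainKind gt (u + 5 * g + 2) (u + 5 * g + 3)

/-- **The kind function of a circuit** with gates `gs` over `S ⊕ Fin u` and output `out`: the
Boolean leaves `0 … u-1`, five nodes per gate, the output operand's node, the root `pass 1`. [folklore] -/
def kindC (out : Operand ℤ (S ⊕ Fin u)) (i : ℕ) : NK (MvPolynomial S ℤ) :=
  if i < u then NK.evar
  else if i < u + 5 * gs.length then
    (match gs[(i - u) / 5]? with
      | none => NK.leaf 0
      | some gt => gateKind gs ((i - u) / 5) gt ((i - u) % 5))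
  else if i = u + 5 * gs.length then opKind gs gs.length 0 (some out)
  else if i = u + 5 * gs.length + 1 then NK.pass 1 (u + 5 * gs.length)
  else NK.leaf 0

/-- Children of operand nodes are below. [folklore] -/
theorem opKind_children (g : ℕ) (dflt : MvPolynomial S ℤ) (o : Option (Operand ℤ (S ⊕ Fin u)))
    (i : ℕ) (hi : u + 5 * g ≤ i) : ∀ a ∈ (opKind gs g dflt o).children, a < i := by
  rcases o with _ | ⟨x | j⟩ | c | j
  · simp [opKind, NK.children]
  · simp [opKind, NK.children]
  · simp only [opKind, NK.children, List.mem_singleton, forall_eq]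
    have := j.isLt; omega
  · simp [opKind, NK.children]
  · simp only [opKind]
    split_ifs with h1 h2
    · simp [NK.children]
    · simp only [NK.children, List.mem_singleton, forall_eq]; omega
    · simp [NK.children]

/-- **Children are below.** [folklore] -/
theorem kindC_children (out : Operand ℤ (S ⊕ Fin u)) (i : ℕ) : ∀ a ∈ (kindC gs out i).children, a < i := by
  unfold kindC
  split_ifs with h1 h2 h3 h4
  · simp [NK.children]
  · cases hg : gs[(i - u) / 5]? with
    | none => simp [NK.children]
    | some gt =>
      simp only
      have hdiv : u + 5 * ((i - u) / 5) + (i - u) % 5 = i := by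
        have := Nat.div_add_mod (i - u) 5; omega
      unfold gateKind
      split_ifs with r0 r1 r2 r3
      · exact opKind_children gs _ _ _ i (by omega)
      · exact opKind_children gs _ _ _ i (by omega)
      · simp only [NK.children, List.mem_singleton, forall_eq]; omega
      · simp only [NK.children, List.mem_singleton, forall_eq]; omega
      · have : (i - u) % 5 = 4 := by have := Nat.mod_lt (i - u) (show 0 < 5 by omega); omega
        intro a ha
        cases gt <;> simp only [mainKind, NK.children, List.mem_cons, List.not_mem_nil,
          or_false] at ha <;> omega
  · exact opKind_children gs _ _ _ i (by omega)
  · simp only [NK.children, List.mem_singleton, forall_eq]; omega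
  · simp [NK.children]

/-- Operand nodes are not Boolean leaves. [folklore] -/
theorem opKind_ne_evar (g : ℕ) (dflt : MvPolynomial S ℤ) (o : Option (Operand ℤ (S ⊕ Fin u))) :
    opKind gs g dflt o ≠ NK.evar := by
  rcases o with _ | ⟨x | j⟩ | c | j <;> simp only [opKind] <;> try split_ifs
  all_goals simp

/-- **The Boolean leaves are exactly the first `u` nodes.** [folklore] -/
theorem kindC_evar (out : Operand ℤ (S ⊕ Fin u)) (i : ℕ) : kindC gs out i = NK.evar ↔ i < u := by
  unfold kindC
  split_ifs with h1 h2 h3 h4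
  · simp [h1]
  · simp only [h1, iff_false]
    cases hg : gs[(i - u) / 5]? with
    | none => simp
    | some gt =>
      simp only
      unfold gateKind
      split_ifs
      · exact opKind_ne_evar gs _ _ _
      · exact opKind_ne_evar gs _ _ _
      · simp
      · simp
      · cases gt <;> simp [mainKind]
  · simp only [h1, iff_false]; exact opKind_ne_evar gs _ _ _
  · simp [h1]
  · simp [h1]

end Kind

/-- **The normalized circuit of a constant-free circuit** over `S ⊕ Fin u` (Boolean variables
`Fin u`): `u + 5 |gates| + 2` nodes, root = the last node. [folklore] -/
def toNCirc (P : ArithCircuit ℤ (S ⊕ Fin u)) : NCirc (MvPolynomial S ℤ) :=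
  NCirc.ofKind u (u + 5 * P.gates.length + 2) (by omega) (kindC P.gates P.output)
    (kindC_children P.gates P.output) (fun i _ => kindC_evar P.gates P.output i)

/-! ### Unfolding the kind function -/

section Unfold

variable (gs : List (Gate ℤ (S ⊕ Fin u))) (out : Operand ℤ (S ⊕ Fin u))

/-- The Boolean leaves. [folklore] -/
theorem kindC_lt (j : ℕ) (hj : j < u) : kindC gs out j = NK.evar := by
  unfold kindC; rw [if_pos hj]

/-- The nodes of a gate. [folklore] -/
theorem kindC_gate (g : ℕ) (hg : g < gs.length) (r : ℕ) (hr : r < 5) (gt : Gate ℤ (S ⊕ Fin u))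
    (hgt : gs[g]? = some gt) : kindC gs out (u + 5 * g + r) = gateKind gs g gt r := by
  unfold kindC
  rw [if_neg (by omega), if_pos (by omega)]
  have h1 : (u + 5 * g + r - u) / 5 = g := by omega
  have h2 : (u + 5 * g + r - u) % 5 = r := by omega
  simp only [h1, h2, hgt]

/-- The output operand's node. [folklore] -/
theorem kindC_out : kindC gs out (u + 5 * gs.length) = opKind gs gs.length 0 (some out) := by
  unfold kindC
  rw [if_neg (by omega), if_neg (by omega), if_pos rfl]

/-- The root. [folklore] -/
theorem kindC_root : kindC gs out (u + 5 * gs.length + 1) = NK.pass 1 (u + 5 * gs.length) := by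
  unfold kindC
  rw [if_neg (by omega), if_neg (by omega), if_neg (by omega), if_pos rfl]

end Unfold

/-! ### The values of the normalized circuit -/

section Values

variable (P : ArithCircuit ℤ (S ⊕ Fin u))

/-- A Boolean point of the Boolean leaves, extended by `false` (this is `NCirc.ext`). [folklore] -/
def extB (e : Fin u → Bool) : ℕ → Bool := fun i => if h : i < u then e ⟨i, h⟩ else false

/-- The Boolean substitution `e`. [folklore] -/
def φ (e : Fin u → Bool) : MvPolynomial (S ⊕ Fin u) ℤ →ₐ[ℤ] MvPolynomial S ℤ :=
  aeval (Sum.elim X fun j => if e j then 1 else 0)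

/-- The kind function of `toNCirc`. [folklore] -/
theorem toNCirc_kind : P.toNCirc.kind = kindC P.gates P.output := rfl

/-- The values of `toNCirc` satisfy the node equations everywhere. [folklore] -/
theorem toNCirc_val_eq (e : ℕ → Bool) (i : ℕ) :
    P.toNCirc.val e i = (kindC P.gates P.output i).eval e i (P.toNCirc.val e) :=
  NCirc.valOf_eq _ e i (kindC_children P.gates P.output i)

/-- The formal degrees of `toNCirc` satisfy the recursion everywhere. [folklore] -/
theorem toNCirc_fd_eq (i : ℕ) : P.toNCirc.fd i = (kindC P.gates P.output i).fdeg P.toNCirc.fd :=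
  NCirc.fdOf_eq _ i (kindC_children P.gates P.output i)

/-- A gate of formal degree `0` computes the constant `cval`. [cite: Burgisser2006, §2.2] -/
theorem getD_gateValues_eq_C (j : ℕ) (hj : j < P.gates.length) (h0 : (gateFormalDegrees P.gates).getD j 1 = 0) :
    (gateValues P.gates).getD j 0 = C (cval P.gates j) := by
  have hlen := gateValues_length (k := ℤ) P.gates
  have hlen' := gateFormalDegrees_length (k := ℤ) P.gates
  have hj' : j < (gateValues P.gates).length := by omega
  rw [List.getD_eq_getElem?_getD, List.getElem?_eq_getElem hj', Option.getD_some]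
  have hdeg := totalDegree_gateValues_le P.gates j hj'
  rw [List.getD_eq_getElem?_getD, List.getElem?_eq_getElem (by omega), Option.getD_some] at h0
  rw [h0, Nat.le_zero] at hdeg
  rw [totalDegree_eq_zero_iff_eq_C] at hdeg
  rw [hdeg]
  congr 1
  unfold cval
  rw [List.getD_eq_getElem?_getD, List.getElem?_eq_getElem hj', Option.getD_some]

/-- The semantics of an operand node. [folklore] -/
def opSem (e : Fin u → Bool) (g : ℕ) (dflt : MvPolynomial S ℤ) : Option (Operand ℤ (S ⊕ Fin u)) → MvPolynomial S ℤ
  | none => dflt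
  | some op => φ e (op.eval ((gateValues P.gates).take g))

/-- **Operand nodes compute the substituted operand value**, given the main nodes of the earlier
gates do. [folklore] -/
theorem val_opKind (e : Fin u → Bool) (g : ℕ) (hg : g ≤ P.gates.length) (dflt : MvPolynomial S ℤ)
    (o : Option (Operand ℤ (S ⊕ Fin u))) (i : ℕ) (hi : kindC P.gates P.output i = opKind P.gates g dflt o)
    (IH : ∀ j < g, P.toNCirc.val (extB e) (u + 5 * j + 4) = φ e ((gateValues P.gates).getD j 0)) :
    P.toNCirc.val (extB e) i = P.opSem e g dflt o := by
  have hlen := gateValues_length (k := ℤ) P.gates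
  rw [toNCirc_val_eq, hi]
  rcases o with _ | ⟨x | j⟩ | c | j
  · rfl
  · simp [opKind, NK.eval, opSem, Operand.eval, φ]
  · simp only [opKind, NK.eval, opSem, Operand.eval, φ, aeval_X, Sum.elim_inr, one_mul]
    rw [toNCirc_val_eq, kindC_lt _ _ _ j.isLt]
    simp [NK.eval, extB]
  · simp [opKind, NK.eval, opSem, Operand.eval, φ]
  · simp only [opKind, opSem, Operand.eval]
    have htake : ((gateValues P.gates).take g).getD j 0 =
        if j < g then (gateValues P.gates).getD j 0 else 0 := by
      rw [List.getD_eq_getElem?_getD, List.getElem?_take, List.getD_eq_getElem?_getD]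
      split_ifs <;> rfl
    rw [htake]
    by_cases h1 : j < g
    · rw [if_pos h1, if_pos h1]
      by_cases h2 : (gateFormalDegrees P.gates).getD j 1 = 0
      · rw [if_pos h2]
        simp only [NK.eval]
        rw [P.getD_gateValues_eq_C j (by omega) h2]
        simp [φ]
      · rw [if_neg h2]
        simp only [NK.eval, one_mul]
        exact IH j h1
    · rw [if_neg h1, if_neg h1]
      simp [NK.eval]

end Values

section MainValues

variable (P : ArithCircuit ℤ (S ⊕ Fin u))

/-- `φ` of a scalar multiple. [folklore] -/
theorem φ_smul (e : Fin u → Bool) (c : ℤ) (q : MvPolynomial (S ⊕ Fin u) ℤ) :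
    φ e (c • q) = C c * φ e q := by
  rw [map_zsmul, MvPolynomial.smul_eq_C_mul]

/-- **The main node of every gate computes the substituted gate value.** [folklore] -/
theorem val_main (h2 : P.IsFanInTwo) (e : Fin u → Bool) :
    ∀ g < P.gates.length, P.toNCirc.val (extB e) (u + 5 * g + 4) = φ e ((gateValues P.gates).getD g 0) := by
  intro g
  induction g using Nat.strong_induction_on with
  | _ g ih =>
    intro hg
    have hlen := gateValues_length (k := ℤ) P.gates
    obtain ⟨gt, hgt⟩ : ∃ gt, P.gates[g]? = some gt := ⟨P.gates[g], List.getElem?_eq_getElem hg⟩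
    have hmem : gt ∈ P.gates := List.mem_of_getElem? hgt
    have hfan : gt.args.length ≤ 2 := h2 gt hmem
    -- the gate value
    have hval : (gateValues P.gates).getD g 0 = gt.eval ((gateValues P.gates).take g) := by
      rw [List.getD_eq_getElem?_getD, DepthReduction.getElem?_gateValues P.gates g hg, hgt]
      rfl
    -- the operand nodes
    have hop : ∀ r < 2, P.toNCirc.val (extB e) (u + 5 * g + r) = P.opSem e g (dfltOf gt) gt.args[r]? := by
      intro r hr
      refine P.val_opKind e g hg.le (dfltOf gt) _ _ ?_ (fun j hj => ih j hj (by omega))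
      rw [kindC_gate P.gates P.output g hg r (by omega) gt hgt]
      unfold gateKind
      rcases Nat.lt_succ_iff_lt_or_eq.1 hr with hr | rfl
      · have : r = 0 := by omega
        subst this
        rfl
      · rfl
    -- the coefficient nodes
    have hco : ∀ r < 2, P.toNCirc.val (extB e) (u + 5 * g + (r + 2)) =
        coefOf gt r * P.opSem e g (dfltOf gt) gt.args[r]? := by
      intro r hr
      rw [toNCirc_val_eq, kindC_gate P.gates P.output g hg (r + 2) (by omega) gt hgt]
      unfold gateKind
      rcases Nat.lt_succ_iff_lt_or_eq.1 hr with hr' | rfl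
      · have : r = 0 := by omega
        subst this
        simp only [show ¬ (0 + 2 = 0) from by omega, show ¬ (0 + 2 = 1) from by omega, if_false, if_true,
          NK.eval]
        rw [show u + 5 * g = u + 5 * g + 0 from rfl, hop 0 (by omega)]
      · simp only [show ¬ (1 + 2 = 0) from by omega, show ¬ (1 + 2 = 1) from by omega,
          show ¬ (1 + 2 = 2) from by omega, if_false, if_true, NK.eval]
        rw [hop 1 (by omega)]
    -- the main node
    rw [toNCirc_val_eq, kindC_gate P.gates P.output g hg 4 (by omega) gt hgt]
    unfold gateKind
    simp only [show ¬ ((4 : ℕ) = 0) from by omega, show ¬ ((4 : ℕ) = 1) from by omega,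
      show ¬ ((4 : ℕ) = 2) from by omega, show ¬ ((4 : ℕ) = 3) from by omega, if_false]
    rw [hval]
    have e2 := hco 0 (by omega)
    have e3 := hco 1 (by omega)
    simp only [Nat.zero_add] at e2
    cases gt with
    | sum args =>
      simp only [mainKind, NK.eval]
      rw [e2, e3]
      simp only [Gate.args, List.length_map] at hfan
      simp only [coefOf, opSem, dfltOf, Gate.args, Gate.eval]
      rcases args with _ | ⟨a, _ | ⟨b, _ | ⟨c, rest⟩⟩⟩
      · simp
      · simp
      · simp
      · simp at hfan
    | prod args =>
      simp only [mainKind, NK.eval]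
      rw [e2, e3]
      simp only [Gate.args] at hfan
      simp only [coefOf, opSem, dfltOf, Gate.args, Gate.eval]
      rcases args with _ | ⟨a, _ | ⟨b, _ | ⟨c, rest⟩⟩⟩
      · simp
      · simp
      · simp
      · simp at hfan

/-- **The root of `toNCirc P` computes `∑`-free: the substituted value of the circuit**,
`val_e (root) = P.eval (X, e)`. [folklore] -/
theorem val_root (h2 : P.IsFanInTwo) (e : Fin u → Bool) :
    P.toNCirc.val (extB e) (u + 5 * P.gates.length + 1) = φ e P.eval := by
  have hlen := gateValues_length (k := ℤ) P.gates
  rw [toNCirc_val_eq, kindC_root]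
  simp only [NK.eval, one_mul]
  rw [P.val_opKind e P.gates.length le_rfl 0 (some P.output) _ (kindC_out P.gates P.output)
    (fun j hj => P.val_main h2 e j hj)]
  simp only [opSem, ArithCircuit.eval]
  rw [List.take_of_length_le (by omega)]

end MainValues

/-! ### The formal degree of the root -/

section Degrees

variable (P : ArithCircuit ℤ (S ⊕ Fin u))

/-- Each entry of `gateFormalDegrees` is the formal degree of its gate against the earlier
entries (cf. `DepthReduction.getElem?_gateValues`). [cite: Burgisser2006, §2.2] -/
theorem getElem?_gateFormalDegrees (gs : List (Gate ℤ (S ⊕ Fin u))) (i : ℕ) (hi : i < gs.length) :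
    (gateFormalDegrees gs)[i]? = (gs[i]?.map fun g => g.formalDegree ((gateFormalDegrees gs).take i)) := by
  induction gs using List.reverseRecOn with
  | nil => simp at hi
  | append_singleton gs g ih =>
    rw [gateFormalDegrees_append_singleton]
    have hlen := gateFormalDegrees_length (k := ℤ) gs
    simp only [List.length_append, List.length_singleton] at hi
    by_cases h : i < gs.length
    · rw [List.getElem?_append_left (by omega), List.getElem?_append_left h, ih h,
        List.take_append_of_le_length (by omega)]
    · have hi' : i = gs.length := by omega
      subst hi'
      rw [List.getElem?_append_right (by omega), List.getElem?_append_right le_rfl, hlen]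
      simp [List.take_append_of_le_length (le_of_eq hlen.symm),
        List.take_of_length_le (le_of_eq hlen)]

/-- The Boolean leaves have formal degree `1`. [folklore] -/
theorem fd_lt (j : ℕ) (hj : j < u) : P.toNCirc.fd j = 1 := by
  rw [toNCirc_fd_eq, kindC_lt _ _ j hj]
  rfl

/-- **Formal degree of an operand node**: `≤ max 1 ((g+1) · formal degree of the operand)`,
given the bound `(j+2) d_j` for the main nodes of the earlier gates of formal degree `d_j ≥ 1`. [folklore] -/
theorem fd_opKind (g : ℕ) (dflt : MvPolynomial S ℤ)
    (o : Option (Operand ℤ (S ⊕ Fin u))) (i : ℕ) (hi : kindC P.gates P.output i = opKind P.gates g dflt o)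
    (IH : ∀ j < g, 1 ≤ (gateFormalDegrees P.gates).getD j 1 →
      P.toNCirc.fd (u + 5 * j + 4) ≤ (j + 2) * (gateFormalDegrees P.gates).getD j 1) :
    P.toNCirc.fd i ≤ max 1 ((g + 1) *
      (o.map fun op => op.formalDegree ((gateFormalDegrees P.gates).take g)).getD 0) := by
  have hlen := gateFormalDegrees_length (k := ℤ) P.gates
  rw [toNCirc_fd_eq, hi]
  rcases o with _ | ⟨x | j⟩ | c | j
  · simp [opKind, NK.fdeg]
  · simp [opKind, NK.fdeg, Operand.formalDegree]
  · simp only [opKind, NK.fdeg, Option.map_some, Option.getD_some, Operand.formalDegree]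
    rw [P.fd_lt j j.isLt]
    exact le_max_left _ _
  · simp [opKind, NK.fdeg, Operand.formalDegree]
  · simp only [opKind, Option.map_some, Option.getD_some, Operand.formalDegree]
    have htake : ((gateFormalDegrees P.gates).take g).getD j 1 =
        if j < g then (gateFormalDegrees P.gates).getD j 1 else 1 := by
      rw [List.getD_eq_getElem?_getD, List.getElem?_take, List.getD_eq_getElem?_getD]
      split_ifs <;> rfl
    rw [htake]
    by_cases h1 : j < g
    · rw [if_pos h1, if_pos h1]
      by_cases h2 : (gateFormalDegrees P.gates).getD j 1 = 0
      · rw [if_pos h2]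
        simp [NK.fdeg]
      · rw [if_neg h2]
        simp only [NK.fdeg]
        refine le_max_of_le_right ((IH j h1 (by omega)).trans ?_)
        exact Nat.mul_le_mul_right _ (by omega)
    · rw [if_neg h1, if_neg h1]
      simp [NK.fdeg]

/-- **Formal degree of the main nodes**: `fd (main g) ≤ (g + 2) · d_g` whenever `d_g ≥ 1`. [folklore] -/
theorem fd_main (h2 : P.IsFanInTwo) :
    ∀ g < P.gates.length, 1 ≤ (gateFormalDegrees P.gates).getD g 1 →
      P.toNCirc.fd (u + 5 * g + 4) ≤ (g + 2) * (gateFormalDegrees P.gates).getD g 1 := by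
  intro g
  induction g using Nat.strong_induction_on with
  | _ g ih =>
    intro hg hd
    have hlen := gateFormalDegrees_length (k := ℤ) P.gates
    obtain ⟨gt, hgt⟩ : ∃ gt, P.gates[g]? = some gt := ⟨P.gates[g], List.getElem?_eq_getElem hg⟩
    have hmem : gt ∈ P.gates := List.mem_of_getElem? hgt
    have hfan : gt.args.length ≤ 2 := h2 gt hmem
    -- the gate's formal degree
    have hdeg : (gateFormalDegrees P.gates).getD g 1 = gt.formalDegree ((gateFormalDegrees P.gates).take g) := by
      rw [List.getD_eq_getElem?_getD, getElem?_gateFormalDegrees P.gates g hg, hgt]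
      rfl
    set T := (gateFormalDegrees P.gates).take g with hT
    -- operand nodes
    have hop : ∀ r < 2, P.toNCirc.fd (u + 5 * g + r) ≤
        max 1 ((g + 1) * ((gt.args[r]?).map fun op => op.formalDegree T).getD 0) := by
      intro r hr
      refine P.fd_opKind g (dfltOf gt) _ _ ?_ (fun j hj hj1 => ih j hj (by omega) hj1)
      rw [kindC_gate P.gates P.output g hg r (by omega) gt hgt]
      unfold gateKind
      rcases Nat.lt_succ_iff_lt_or_eq.1 hr with hr | rfl
      · have : r = 0 := by omega
        subst this; rfl
      · rfl
    -- coefficient nodes have the same formal degree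
    have hco : ∀ r < 2, P.toNCirc.fd (u + 5 * g + (r + 2)) = P.toNCirc.fd (u + 5 * g + r) := by
      intro r hr
      rw [toNCirc_fd_eq, kindC_gate P.gates P.output g hg (r + 2) (by omega) gt hgt]
      unfold gateKind
      rcases Nat.lt_succ_iff_lt_or_eq.1 hr with hr' | rfl
      · have : r = 0 := by omega
        subst this
        simp only [show ¬ (0 + 2 = 0) from by omega, show ¬ (0 + 2 = 1) from by omega, if_false, if_true,
          NK.fdeg]
        rfl
      · simp only [show ¬ (1 + 2 = 0) from by omega, show ¬ (1 + 2 = 1) from by omega,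
          show ¬ (1 + 2 = 2) from by omega, if_false, if_true, NK.fdeg]
    rw [toNCirc_fd_eq, kindC_gate P.gates P.output g hg 4 (by omega) gt hgt]
    unfold gateKind
    simp only [show ¬ ((4 : ℕ) = 0) from by omega, show ¬ ((4 : ℕ) = 1) from by omega,
      show ¬ ((4 : ℕ) = 2) from by omega, show ¬ ((4 : ℕ) = 3) from by omega, if_false]
    rw [hdeg] at hd ⊢
    have e0 := hop 0 (by omega)
    have e1 := hop 1 (by omega)
    have c0 := hco 0 (by omega)
    have c1 := hco 1 (by omega)
    simp only [Nat.zero_add, Nat.add_zero] at e0 c0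
    cases gt with
    | sum args =>
      simp only [mainKind, NK.fdeg]
      rw [c0, c1]
      simp only [Gate.args, List.length_map] at hfan
      simp only [Gate.args, Gate.formalDegree] at e0 e1 hd ⊢
      rcases args with _ | ⟨a, _ | ⟨b, _ | ⟨c, rest⟩⟩⟩
      · simp at hd
      · simp only [List.map_cons, List.map_nil, List.getElem?_cons_zero, Option.map_some, Option.getD_some,
          List.getElem?_cons_succ, List.getElem?_nil, Option.map_none, Option.getD_none, mul_zero,
          List.foldr_cons, List.foldr_nil] at e0 e1 hd ⊢
        have ha : max (a.2.formalDegree T) 0 = a.2.formalDegree T := Nat.max_eq_left (Nat.zero_le _)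
        rw [ha] at hd ⊢
        refine max_le (e0.trans (max_le (by nlinarith) (Nat.mul_le_mul_right _ (by omega)))) ?_
        exact e1.trans (by simp; nlinarith)
      · simp only [List.map_cons, List.map_nil, List.getElem?_cons_zero, Option.map_some, Option.getD_some,
          List.getElem?_cons_succ, List.foldr_cons, List.foldr_nil] at e0 e1 hd ⊢
        have hb : max (b.2.formalDegree T) 0 = b.2.formalDegree T := Nat.max_eq_left (Nat.zero_le _)
        rw [hb] at hd ⊢
        refine max_le (e0.trans (max_le (by nlinarith) ?_)) (e1.trans (max_le (by nlinarith) ?_))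
        · exact (Nat.mul_le_mul_right _ (by omega : g + 1 ≤ g + 2)).trans
            (Nat.mul_le_mul_left _ (le_max_left _ _))
        · exact (Nat.mul_le_mul_right _ (by omega : g + 1 ≤ g + 2)).trans
            (Nat.mul_le_mul_left _ (le_max_right _ _))
      · simp at hfan
    | prod args =>
      simp only [mainKind, NK.fdeg]
      rw [c0, c1]
      simp only [Gate.args] at hfan
      simp only [Gate.args, Gate.formalDegree] at e0 e1 hd ⊢
      rcases args with _ | ⟨a, _ | ⟨b, _ | ⟨c, rest⟩⟩⟩
      · simp at hd
      · simp only [List.map_cons, List.map_nil, List.getElem?_cons_zero, Option.map_some, Option.getD_some,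
          List.getElem?_cons_succ, List.getElem?_nil, Option.map_none, Option.getD_none, mul_zero,
          List.sum_cons, List.sum_nil, Nat.add_zero] at e0 e1 hd ⊢
        have e1' : P.toNCirc.fd (u + 5 * g + 1) ≤ 1 := e1.trans (by simp)
        have e0' := e0.trans (max_le (by nlinarith : 1 ≤ (g + 1) * a.formalDegree T) le_rfl)
        nlinarith
      · simp only [List.map_cons, List.map_nil, List.getElem?_cons_zero, Option.map_some, Option.getD_some,
          List.getElem?_cons_succ, List.sum_cons, List.sum_nil, Nat.add_zero] at e0 e1 hd ⊢
        -- case analysis on which operand degrees vanish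
        rcases Nat.eq_zero_or_pos (a.formalDegree T) with ha | ha <;>
          rcases Nat.eq_zero_or_pos (b.formalDegree T) with hb | hb
        · omega
        · rw [ha] at e0 ⊢
          simp only [mul_zero] at e0
          have e0' : P.toNCirc.fd (u + 5 * g) ≤ 1 := e0.trans (by simp)
          have e1' := e1.trans (max_le (by nlinarith : 1 ≤ (g + 1) * b.formalDegree T) le_rfl)
          nlinarith
        · rw [hb] at e1 ⊢
          simp only [mul_zero] at e1
          have e1' : P.toNCirc.fd (u + 5 * g + 1) ≤ 1 := e1.trans (by simp)
          have e0' := e0.trans (max_le (by nlinarith : 1 ≤ (g + 1) * a.formalDegree T) le_rfl)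
          nlinarith
        · have e0' := e0.trans (max_le (by nlinarith : 1 ≤ (g + 1) * a.formalDegree T) le_rfl)
          have e1' := e1.trans (max_le (by nlinarith : 1 ≤ (g + 1) * b.formalDegree T) le_rfl)
          nlinarith
      · simp at hfan

/-- **The formal degree of the root**: `fd (root) ≤ (|gates| + 1) · formalDegree P + 1`. [folklore] -/
theorem fd_root (h2 : P.IsFanInTwo) :
    P.toNCirc.fd (u + 5 * P.gates.length + 1) ≤ (P.gates.length + 1) * P.formalDegree + 1 := by
  have hlen := gateFormalDegrees_length (k := ℤ) P.gates
  rw [toNCirc_fd_eq, kindC_root]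
  simp only [NK.fdeg]
  have h := P.fd_opKind P.gates.length 0 (some P.output) _ (kindC_out P.gates P.output)
    (fun j hj hj1 => P.fd_main h2 j hj hj1)
  simp only [Option.map_some, Option.getD_some] at h
  rw [List.take_of_length_le (by omega)] at h
  unfold ArithCircuit.formalDegree
  rcases le_max_iff.1 h with h | h <;> omega

end Degrees

/-! ### The parameters: leaf labels and coefficients -/

section Params

variable (P : ArithCircuit ℤ (S ⊕ Fin u))

/-- **The admissible parameters** of the normalized circuit of a constant-free circuit of size
`≤ s`: `0`, `1`, `-1`, a variable, or an integer constant of `τ`-complexity `≤ s` (the value of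
a sub-circuit of formal degree `0`). [folklore] -/
def GoodParam (s : ℕ) (x : MvPolynomial S ℤ) : Prop :=
  x = 0 ∨ x = 1 ∨ x = -1 ∨ (∃ v, x = X v) ∨ ∃ c : ℤ, x = C c ∧ constantFreeComplexity (C c : MvPolynomial S ℤ) ≤ s

/-- The parameters of a node kind. [folklore] -/
def _root_.Literature.Computability.AlgebraicComplexity.NK.ParamIn {R : Type u} (Q : R → Prop) : NK R → Prop
  | NK.leaf ℓ => Q ℓ
  | NK.pass c _ => Q c
  | _ => True

/-- `GoodParam` is monotone in the size bound. [folklore] -/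
theorem GoodParam.mono {s s' : ℕ} (h : s ≤ s') {x : MvPolynomial S ℤ} (hx : GoodParam s x) : GoodParam s' x := by
  rcases hx with hx | hx | hx | hx | ⟨c, rfl, hc⟩
  · exact Or.inl hx
  · exact Or.inr (Or.inl hx)
  · exact Or.inr (Or.inr (Or.inl hx))
  · exact Or.inr (Or.inr (Or.inr (Or.inl hx)))
  · exact Or.inr (Or.inr (Or.inr (Or.inr ⟨c, rfl, hc.trans h⟩)))

/-- A sign constant is a good parameter. [folklore] -/
theorem goodParam_C_of_isSignConstant (s : ℕ) {c : ℤ} (hc : IsSignConstant c) : GoodParam s (C c : MvPolynomial S ℤ) := by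
  rcases hc with rfl | rfl | h
  · exact Or.inl (by simp)
  · exact Or.inr (Or.inl (by simp))
  · have : c = -1 := by omega
    subst this
    exact Or.inr (Or.inr (Or.inl (by simp)))

/-- The value list of a prefix of the gate list is the prefix of the value list. [folklore] -/
theorem gateValues_take (gs : List (Gate ℤ (S ⊕ Fin u))) (n : ℕ) :
    gateValues (gs.take n) = (gateValues gs).take n := by
  induction gs using List.reverseRecOn with
  | nil => simp [gateValues]
  | append_singleton gs g ih =>
    have hlen := gateValues_length (k := ℤ) gs
    by_cases h : n ≤ gs.length
    · rw [List.take_append_of_le_length h, ih, gateValues_append_singleton,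
        List.take_append_of_le_length (by omega)]
    · rw [List.take_of_length_le (by simp; omega), List.take_of_length_le]
      simp [hlen]; omega

/-- **The `τ`-complexity of the value of a gate of formal degree `0`** is at most the size: the
prefix circuit computes it, and killing the variables costs nothing. [cite: Burgisser2000, §1.4] -/
theorem constantFreeComplexity_cval_le [Fintype S] (h2 : P.IsFanInTwo) (hsc : P.HasSignConstants) (j : ℕ)
    (hj : j < P.gates.length) (h0 : (gateFormalDegrees P.gates).getD j 1 = 0) :
    constantFreeComplexity (C (cval P.gates j) : MvPolynomial S ℤ) ≤ P.gates.length := by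
  have hlen := gateValues_length (k := ℤ) P.gates
  -- the prefix circuit computes the constant
  let Q : ArithCircuit ℤ (S ⊕ Fin u) := ⟨P.gates.take (j + 1), .gate j⟩
  have hQ2 : Q.IsFanInTwo := fun g hg => h2 g (List.mem_of_mem_take hg)
  have hQs : Q.HasSignConstants := ⟨fun g hg => hsc.1 g (List.mem_of_mem_take hg), trivial⟩
  have hQc : Q.Computes (C (cval P.gates j)) := by
    show Operand.eval (gateValues (P.gates.take (j + 1))) (.gate j) = _
    simp only [Operand.eval]
    rw [gateValues_take, List.getD_eq_getElem?_getD, List.getElem?_take, if_pos (by omega),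
      ← List.getD_eq_getElem?_getD, P.getD_gateValues_eq_C j hj h0]
  have hτ : constantFreeComplexity (C (cval P.gates j) : MvPolynomial (S ⊕ Fin u) ℤ) ≤ j + 1 := by
    refine (constantFreeComplexity_le_size hQ2 hQs hQc).trans ?_
    show (P.gates.take (j + 1)).length ≤ j + 1
    simp
  -- kill the variables
  have hkill := constantFreeComplexity_aeval_le (C (cval P.gates j) : MvPolynomial (S ⊕ Fin u) ℤ)
    (Sum.elim X fun _ : Fin u => (0 : MvPolynomial S ℤ))
  rw [algHom_C] at hkill
  have hz : ∑ i : S ⊕ Fin u, constantFreeComplexity (Sum.elim X (fun _ : Fin u => (0 : MvPolynomial S ℤ)) i) = 0 :=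
    Finset.sum_eq_zero fun i _ => by rcases i with x | j <;> simp
  rw [hz, add_zero] at hkill
  exact hkill.trans (hτ.trans (by omega))

/-- The parameters of an operand node. [folklore] -/
theorem paramIn_opKind [Fintype S] (h2 : P.IsFanInTwo) (hsc : P.HasSignConstants) (g : ℕ) (hg : g ≤ P.gates.length)
    (dflt : MvPolynomial S ℤ) (hd : GoodParam P.gates.length dflt) (o : Option (Operand ℤ (S ⊕ Fin u)))
    (ho : ∀ op, o = some op → op.HasSignConstants) :
    (opKind P.gates g dflt o).ParamIn (GoodParam P.gates.length) := by
  rcases o with _ | ⟨x | j⟩ | c | j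
  · exact hd
  · exact Or.inr (Or.inr (Or.inr (Or.inl ⟨x, rfl⟩)))
  · exact Or.inr (Or.inl rfl)
  · exact goodParam_C_of_isSignConstant _ (ho _ rfl)
  · simp only [opKind]
    split_ifs with h1 h0
    · exact Or.inr (Or.inr (Or.inr (Or.inr ⟨_, rfl, P.constantFreeComplexity_cval_le h2 hsc j (by omega) h0⟩)))
    · exact Or.inr (Or.inl rfl)
    · exact Or.inl rfl

/-- **All parameters of `toNCirc P` are good.** [folklore] -/
theorem paramIn_kindC [Fintype S] (h2 : P.IsFanInTwo) (hsc : P.HasSignConstants) (i : ℕ) :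
    (kindC P.gates P.output i).ParamIn (GoodParam P.gates.length) := by
  unfold kindC
  split_ifs with h1 h2' h3 h4
  · trivial
  · cases hg : P.gates[(i - u) / 5]? with
    | none => exact Or.inl rfl
    | some gt =>
      simp only
      have hmem : gt ∈ P.gates := List.mem_of_getElem? hg
      have hlt : (i - u) / 5 < P.gates.length := by
        rcases List.getElem?_eq_some_iff.1 hg with ⟨h, -⟩; exact h
      have hgs := hsc.1 gt hmem
      have hops : ∀ (r : ℕ) (op : Operand ℤ (S ⊕ Fin u)), gt.args[r]? = some op → op.HasSignConstants := by
        intro r op hop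
        have hm : op ∈ gt.args := List.mem_of_getElem? hop
        cases gt with
        | sum args =>
          simp only [Gate.args, List.mem_map] at hm
          obtain ⟨a, ha, rfl⟩ := hm
          exact (hgs a ha).2
        | prod args => exact hgs op hm
      have hdflt : GoodParam P.gates.length (dfltOf gt) := by
        cases gt
        · exact Or.inl rfl
        · exact Or.inr (Or.inl rfl)
      have hcoef : ∀ r, GoodParam P.gates.length (coefOf gt r) := by
        intro r
        cases gt with
        | sum args =>
          simp only [coefOf]
          cases ha : args[r]? with
          | none => exact Or.inl rfl
          | some a => exact goodParam_C_of_isSignConstant _ (hgs a (List.mem_of_getElem? ha)).1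
        | prod args => exact Or.inr (Or.inl rfl)
      unfold gateKind
      split_ifs
      · exact P.paramIn_opKind h2 hsc _ hlt.le _ hdflt _ (hops 0)
      · exact P.paramIn_opKind h2 hsc _ hlt.le _ hdflt _ (hops 1)
      · exact hcoef 0
      · exact hcoef 1
      · cases gt <;> trivial
  · exact P.paramIn_opKind h2 hsc _ le_rfl _ (Or.inl rfl) _ (fun op hop => by cases hop; exact hsc.2)
  · exact Or.inr (Or.inl rfl)
  · exact Or.inl rfl

end Params

end ArithCircuit

end

end Literature.Computability.AlgebraicComplexity
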